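import Summits.RiemannHypothesis.RiemannHypothesis.Theorems.SoloInformedBlaschkePrice

/-!
# T40c — Hypothesis-free reach of the Blaschke window inequality

The Blaschke sum of T40 is bounded using only the density of zeros
(`Σ_ρ m_ρ/(1+(Im ρ-γ₀)²) ≤ 2A₁ log(|γ₀|+2)`) and an isolation radius `r` of the target:
every companion `ρ ≠ ρ₀` costs at most `(2 log(1 + 8η/r²) + 16η) · m_ρ/(1 + (Im ρ - γ₀)²)`, so

  `η(2a-2) ≤ log B_J + 2A₁ log(|γ₀|+2) · (log(1 + 8η/r²) + 8η)`.

No count, position, flatness or multiplicity hypothesis on the companions remains; contrapositively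
(`riemannZeta_ne_zero_of_blaschke`), ground-state positivity at window `a` excludes every zero of
offset `η`, isolation `r` and height `|γ₀| ≥ 2πK` violating this inequality — a reach
`log|γ₀| ≍ a` at fixed `η, r`, against the `log log` reach of the count-conditional T39.
-/

noncomputable section

open Real Complex Set MeasureTheory Finset Literature.NumberTheory.LFunctions
open scoped ComplexConjugate

namespace Summit.RiemannHypothesis.RiemannHypothesis.Theorems

open Blaschke

/-- Density of zeros around height `γ₀`, finite-set form:
`Σ_{ρ ∈ Q} m_ρ/(1 + (Im ρ - γ₀)²) ≤ 2A₁ log(|γ₀| + 2)`. -/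
theorem sum_zeros_kernel_le (γ₀ : ℝ) (Q : Finset ℂ)
    (hQ : ∀ ρ ∈ Q, riemannZeta ρ = 0 ∧ 0 ≤ ρ.re ∧ ρ.re ≤ 1 ∧ ρ.im ≠ 0) :
    ∑ ρ ∈ Q, (riemannZetaZeroOrder ρ : ℝ) * (1 / (1 + (ρ.im - γ₀) ^ 2)) ≤
      2 * zetaDensityConst * Real.log (|γ₀| + 2) := by
  classical
  set T : ℝ := ∑ ρ ∈ Q, |ρ.im|
  have hfin := weilZeroIndex_finite T
  have hQT : Q ⊆ hfin.toFinset := by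
    intro ρ hρ
    obtain ⟨hz, h0, h1, him⟩ := hQ ρ hρ
    exact hfin.mem_toFinset.mpr ⟨hz, h0, h1, him,
      Finset.single_le_sum (fun ρ _ ↦ abs_nonneg (Complex.im ρ)) hρ⟩
  have h := finsum_weilZeroIndex_le_of_kernel_bound_eff (fun ρ ↦ 1 / (1 + (ρ.im - γ₀) ^ 2)) 1
    γ₀ zero_le_one (fun ρ _ _ ↦ le_rfl) T
  rw [mul_one, finsum_mem_eq_finite_toFinset_sum _ hfin] at h
  refine (Finset.sum_le_sum_of_subset_of_nonneg hQT fun ρ hρ _ ↦ ?_).trans h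
  exact mul_nonneg (riemannZetaZeroOrder_nonneg_of_zero (hfin.mem_toFinset.mp hρ).1)
    (by positivity)

/-- The price of one companion: with `x = Re ρ - ½ ∈ (0, ½)`, `y = Im ρ - γ₀`,
`(η - x)² + y² ≥ r²`, one has
`log(((3η+x)² + y²)/((η-x)² + y²)) ≤ (2 log(1 + 8η/r²) + 16η)/(1 + y²)`. -/
theorem log_blaschke_factor_le {η x y r : ℝ} (hη : 0 < η) (hη1 : η ≤ 1 / 2) (hx : 0 < x)
    (hx1 : x ≤ 1 / 2) (hr : 0 < r) (hd : r ^ 2 ≤ (η - x) ^ 2 + y ^ 2) :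
    Real.log (((3 * η + x) ^ 2 + y ^ 2) / ((η - x) ^ 2 + y ^ 2)) ≤
      (2 * Real.log (1 + 8 * η / r ^ 2) + 16 * η) / (1 + y ^ 2) := by
  have hD : 0 < (η - x) ^ 2 + y ^ 2 := lt_of_lt_of_le (by positivity) hd
  have hid : ((3 * η + x) ^ 2 + y ^ 2) / ((η - x) ^ 2 + y ^ 2) =
      1 + 8 * η * (η + x) / ((η - x) ^ 2 + y ^ 2) := by
    field_simp; ring
  rw [hid]
  have hηx : η + x ≤ 1 := by linarith
  have hℓ : 0 ≤ Real.log (1 + 8 * η / r ^ 2) := Real.log_nonneg (by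
    have : 0 ≤ 8 * η / r ^ 2 := by positivity
    linarith)
  have hq0 : 0 ≤ 8 * η * (η + x) / ((η - x) ^ 2 + y ^ 2) := by positivity
  rcases lt_or_ge (|y|) 1 with hy | hy
  · -- near companion: the isolation radius prices it
    have h1 : 8 * η * (η + x) / ((η - x) ^ 2 + y ^ 2) ≤ 8 * η / r ^ 2 := by
      rw [div_le_div_iff₀ hD (by positivity)]
      have := mul_le_mul_of_nonneg_left hd (by positivity : (0 : ℝ) ≤ 8 * η)
      nlinarith [mul_le_mul_of_nonneg_left hηx (by positivity : (0 : ℝ) ≤ 8 * η * r ^ 2)]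
    have h2 : Real.log (1 + 8 * η * (η + x) / ((η - x) ^ 2 + y ^ 2)) ≤
        Real.log (1 + 8 * η / r ^ 2) := Real.log_le_log (by linarith) (by linarith)
    have hy2 : y ^ 2 < 1 := by
      have := abs_nonneg y
      calc y ^ 2 = |y| ^ 2 := (sq_abs y).symm
        _ < 1 := by nlinarith
    rw [le_div_iff₀ (by positivity)]
    nlinarith
  · -- far companion: `log(1+t) ≤ t ≤ 8η/y² ≤ 16η/(1+y²)`
    have hy2 : 1 ≤ y ^ 2 := by
      calc (1 : ℝ) ≤ |y| ^ 2 := by nlinarith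
        _ = y ^ 2 := sq_abs y
    have h1 : Real.log (1 + 8 * η * (η + x) / ((η - x) ^ 2 + y ^ 2)) ≤
        8 * η * (η + x) / ((η - x) ^ 2 + y ^ 2) := by
      have := Real.log_le_sub_one_of_pos (by linarith : 0 < 1 + 8 * η * (η + x) /
        ((η - x) ^ 2 + y ^ 2))
      linarith
    have h2 : 8 * η * (η + x) / ((η - x) ^ 2 + y ^ 2) ≤ 16 * η / (1 + y ^ 2) := by
      rw [div_le_div_iff₀ hD (by positivity)]
      have hsq := sq_nonneg (η - x)
      nlinarith [mul_le_mul_of_nonneg_left hηx (by positivity : (0 : ℝ) ≤ 8 * η * (1 + y ^ 2)),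
        mul_nonneg (by positivity : (0 : ℝ) ≤ 16 * η) hsq]
    have h3 : 16 * η / (1 + y ^ 2) ≤ (2 * Real.log (1 + 8 * η / r ^ 2) + 16 * η) / (1 + y ^ 2) :=
      div_le_div_of_nonneg_right (by linarith) (by positivity)
    linarith

/-- **T40c (hypothesis-free reach).**  Under `E₀(a) ≥ 0`, a zero `ρ₀ = ½ + η + iγ₀` at distance
`≥ r` from every other zero with `Re ρ > ½` in its zone satisfies
`η(2a-2) ≤ log B_J + 2A₁ log(|γ₀|+2) (log(1 + 8η/r²) + 8η)`. -/
theorem blaschke_reach {η : ℝ} (hη : 0 < η) {J K q : ℕ} (hq : 2 ≤ q) (hK : 1 ≤ K)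
    (hKJ : K ≤ J) {a γ₀ r : ℝ} (ha : 2 ≤ a) (hr : 0 < r) (hγ : π * (J + K) ≤ |γ₀|)
    (hK2 : Real.exp a * (2 * combL q / (π * K) ^ (q - 2)) ^ 2 ≤ combC ^ 2)
    (hε : 2 * combL q / (π ^ q * K ^ (q - 1)) ≤ 1 / 4) (P : Finset ℂ)
    (hmem : ∀ ρ, ρ ∈ P ↔ riemannZeta ρ = 0 ∧ 1 / 2 < ρ.re ∧ |ρ.im - γ₀| < π * (J + K))
    (hiso : ∀ ρ ∈ P, ρ ≠ 1 / 2 + η + γ₀ * I → r ≤ ‖ρ - (1 / 2 + η + γ₀ * I)‖)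
    (hE : 0 ≤ weilGroundEnergy a) (hζ : riemannZeta (1 / 2 + η + γ₀ * I) = 0) :
    η * (2 * a - 2) ≤
      Real.log (20 * π * zetaDensityConst * combC ^ 2 * (2 * J + 1) *
          Real.log (|γ₀| + π * J + 2)) +
        2 * zetaDensityConst * Real.log (|γ₀| + 2) *
          (Real.log (1 + 8 * η / r ^ 2) + 8 * η) := by
  classical
  have hlog := blaschke_window_log hη hq hK hKJ ha hγ hK2 hε P hmem hE hζ
  set ρ₀ : ℂ := 1 / 2 + η + γ₀ * I with hρ₀
  set Q := P.erase ρ₀ with hQ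
  have hP : ∀ ρ ∈ P, riemannZeta ρ = 0 ∧ 1 / 2 < ρ.re ∧ |ρ.im - γ₀| < π * (J + K) :=
    fun ρ hρ ↦ (hmem ρ).mp hρ
  have hη1 : η ≤ 1 / 2 := by
    have := re_lt_one_of_riemannZeta_eq_zero hζ
    have hre : ρ₀.re = 1 / 2 + η := by simp [hρ₀]
    rw [hre] at this; linarith
  set ℓ : ℝ := 2 * Real.log (1 + 8 * η / r ^ 2) + 16 * η with hℓ
  have hℓ0 : 0 ≤ ℓ := by
    have : 0 ≤ Real.log (1 + 8 * η / r ^ 2) := Real.log_nonneg (by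
      have : 0 ≤ 8 * η / r ^ 2 := by positivity
      linarith)
    rw [hℓ]; positivity
  -- termwise bound
  have hterm : ∀ ρ ∈ Q, Real.log (((3 * η + (ρ.re - 1 / 2)) ^ 2 + (ρ.im - γ₀) ^ 2) /
      ((η - (ρ.re - 1 / 2)) ^ 2 + (ρ.im - γ₀) ^ 2)) ≤
      ℓ * ((riemannZetaZeroOrder ρ : ℝ) * (1 / (1 + (ρ.im - γ₀) ^ 2))) := by
    intro ρ hρ
    obtain ⟨hne, hρP⟩ := Finset.mem_erase.mp hρ
    obtain ⟨hz, hre, -⟩ := hP ρ hρP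
    have h1 := re_lt_one_of_riemannZeta_eq_zero hz
    have hm1 : (1 : ℝ) ≤ riemannZetaZeroOrder ρ := by
      have := (riemannZetaZeroOrder_pos_iff (ne_one_of_riemannZeta_eq_zero hz)).mpr hz
      exact_mod_cast this
    have hd : r ^ 2 ≤ (η - (ρ.re - 1 / 2)) ^ 2 + (ρ.im - γ₀) ^ 2 := by
      have hn : ‖ρ - ρ₀‖ ^ 2 = (η - (ρ.re - 1 / 2)) ^ 2 + (ρ.im - γ₀) ^ 2 := by
        rw [Complex.sq_norm, Complex.normSq_apply]
        simp [hρ₀]; ring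
      rw [← hn]
      exact pow_le_pow_left₀ hr.le (hiso ρ hρP hne) 2
    have key := log_blaschke_factor_le hη hη1 (by linarith) (by linarith) hr hd
    calc Real.log (((3 * η + (ρ.re - 1 / 2)) ^ 2 + (ρ.im - γ₀) ^ 2) /
          ((η - (ρ.re - 1 / 2)) ^ 2 + (ρ.im - γ₀) ^ 2))
        ≤ ℓ / (1 + (ρ.im - γ₀) ^ 2) := key
      _ = ℓ * (1 * (1 / (1 + (ρ.im - γ₀) ^ 2))) := by ring
      _ ≤ ℓ * ((riemannZetaZeroOrder ρ : ℝ) * (1 / (1 + (ρ.im - γ₀) ^ 2))) := by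
          gcongr
  have hQ' : ∀ ρ ∈ Q, riemannZeta ρ = 0 ∧ 0 ≤ ρ.re ∧ ρ.re ≤ 1 ∧ ρ.im ≠ 0 := by
    intro ρ hρ
    obtain ⟨hz, hre, him⟩ := hP ρ (Finset.mem_of_mem_erase hρ)
    refine ⟨hz, by linarith, (re_lt_one_of_riemannZeta_eq_zero hz).le, ?_⟩
    intro h0
    rw [h0, zero_sub, abs_neg] at him
    have : (0 : ℝ) ≤ π * (J + K) := by positivity
    linarith
  have hsum := sum_zeros_kernel_le γ₀ Q hQ'
  have htot : ∑ ρ ∈ Q, Real.log (((3 * η + (ρ.re - 1 / 2)) ^ 2 + (ρ.im - γ₀) ^ 2) /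
      ((η - (ρ.re - 1 / 2)) ^ 2 + (ρ.im - γ₀) ^ 2)) ≤
      ℓ * (2 * zetaDensityConst * Real.log (|γ₀| + 2)) := by
    refine (Finset.sum_le_sum hterm).trans ?_
    rw [← Finset.mul_sum]
    exact mul_le_mul_of_nonneg_left hsum hℓ0
  have : ℓ * (2 * zetaDensityConst * Real.log (|γ₀| + 2)) / 2 =
      2 * zetaDensityConst * Real.log (|γ₀| + 2) * (Real.log (1 + 8 * η / r ^ 2) + 8 * η) := by
    rw [hℓ]; ring
  linarith [div_le_div_of_nonneg_right htot (by norm_num : (0 : ℝ) ≤ 2)]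

/-- **T40c, contrapositive: the hypothesis-free exclusion theorem.**  Ground-state positivity
at window `a` excludes every zero `½ + η + iγ₀` (`|γ₀| ≥ π(J+K)`) isolated by `r` from the
other zeros with `Re ρ > ½` of its zone, as soon as
`log B_J + 2A₁ log(|γ₀|+2)(log(1 + 8η/r²) + 8η) < η(2a-2)`. -/
theorem riemannZeta_ne_zero_of_blaschke {η : ℝ} (hη : 0 < η) {J K q : ℕ} (hq : 2 ≤ q)
    (hK : 1 ≤ K) (hKJ : K ≤ J) {a γ₀ r : ℝ} (ha : 2 ≤ a) (hr : 0 < r)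
    (hγ : π * (J + K) ≤ |γ₀|)
    (hK2 : Real.exp a * (2 * combL q / (π * K) ^ (q - 2)) ^ 2 ≤ combC ^ 2)
    (hε : 2 * combL q / (π ^ q * K ^ (q - 1)) ≤ 1 / 4)
    (hiso : ∀ ρ : ℂ, riemannZeta ρ = 0 → 1 / 2 < ρ.re → ρ ≠ 1 / 2 + η + γ₀ * I →
      r ≤ ‖ρ - (1 / 2 + η + γ₀ * I)‖)
    (hE : 0 ≤ weilGroundEnergy a)
    (hwin : Real.log (20 * π * zetaDensityConst * combC ^ 2 * (2 * J + 1) *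
          Real.log (|γ₀| + π * J + 2)) +
        2 * zetaDensityConst * Real.log (|γ₀| + 2) *
          (Real.log (1 + 8 * η / r ^ 2) + 8 * η) < η * (2 * a - 2)) :
    riemannZeta (1 / 2 + η + γ₀ * I) ≠ 0 := by
  classical
  intro hζ
  set R : ℝ := π * (J + K) with hR
  set Z : Set ℂ := {ρ : ℂ | riemannZeta ρ = 0 ∧ 1 / 2 < ρ.re ∧ |ρ.im - γ₀| < R} with hZ
  have hfin : Z.Finite := by
    refine (((isCompact_Icc (a := (1 / 2 : ℝ)) (b := 1)).reProdIm
      (isCompact_Icc (a := γ₀ - R) (b := γ₀ + R))).inter_riemannZetaZeros_finite).subset ?_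
    rintro ρ ⟨hz, hre, him⟩
    refine ⟨Complex.mem_reProdIm.2 ⟨⟨hre.le, (re_lt_one_of_riemannZeta_eq_zero hz).le⟩, ?_⟩,
      mem_riemannZetaZeros.mpr hz⟩
    rw [abs_lt] at him
    exact ⟨by linarith, by linarith⟩
  set P : Finset ℂ := hfin.toFinset
  have hmem : ∀ ρ, ρ ∈ P ↔ riemannZeta ρ = 0 ∧ 1 / 2 < ρ.re ∧ |ρ.im - γ₀| < π * (J + K) := by
    intro ρ; rw [hfin.mem_toFinset]; rfl
  have hisoP : ∀ ρ ∈ P, ρ ≠ 1 / 2 + η + γ₀ * I → r ≤ ‖ρ - (1 / 2 + η + γ₀ * I)‖ :=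
    fun ρ hρ hne ↦ hiso ρ ((hmem ρ).mp hρ).1 ((hmem ρ).mp hρ).2.1 hne
  have := blaschke_reach hη hq hK hKJ ha hr hγ hK2 hε P hmem hisoP hE hζ
  linarith

end Summit.RiemannHypothesis.RiemannHypothesis.Theorems
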